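import Literature.MathematicalPhysics.QuantumFieldTheory.ConformalBootstrap3D.PointKernelMono
import HarnessLib

/-!
# Mono-term positivity cells through the v3 kernel: odd spin at head level zero

[folklore] validated numerics on top of [cite: HogervorstRychkov2013, §3 eq. (3.6)] (the
truncated-block minorant) and [cite: HogervorstRychkov2013, §3 eq. (3.9)] (the head sums).

`PointKernelMono` certifies `0 ≤ φ_s(crossF_s 𝓜_{E,j})` on a cell `E ∈ [A - h, A + h]`,
`s ∈ [s_lo, s_hi]`, from a passing v3 kernel cell run at `ℓ := j`, `n_F := 0`, for EVEN `j`: the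
node model `nodeMomTM` encloses the node head sum `H = Σ A_{n,j'} u^{(n-j')/2} 𝒫_{j'}` through
the floors `U_n = ⌊u^{⌊n/2⌋} S⌋`, `V_{j'} = ⌊u^{-⌊j'/2⌋} 𝒫_{j'} S⌋`, and `u^{(n-j')/2} = u^{⌊n/2⌋}
u^{-⌊j'/2⌋}` only for same-parity `(n, j')`.  This file records the parity-free content of that
computation — the model always encloses the FLOOR FORM
`Σ A_{n,j'} u^{⌊n/2⌋} (𝒫_{j'} u^{-⌊j'/2⌋})` (`headFloorForm`, `tmem_moments_gform`) — and the
observation that for ODD `j` at `n_F = 0` (only head term `(0, j)`, `A_{0,j} = 1`) the floor form is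
`u^{-⌊j/2⌋} 𝒫_j = u^{1/2} · H` (`tmem_moments_odd`).  Hence the UNCHANGED kernel functions
(`sideCore`, `sideG`, `gPart`, `PartsOK`, `cellNumber`, `CellPass`, `chainOK`) are sound for odd
`j`, `n_F = 0`, as soon as the power request `rA` of the cell carries the exponent `(A - 1)/2` in
place of `A/2`, by `u^{(A+ρ)/2} H = u^{(A-1)/2} · e^{ρ log u / 2} · (u^{1/2} H)`
(`tmem_sideCore_odd`, `tmem_sideG_odd`).  The group / partition / cell-number layer is redone
once under an abstract node-side hypothesis (`SideSound`, `headG_nonneg_of_sideSound`), and the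
end product `PKTM.monoPosOdd_of_cellPass` has exactly the conclusion shape of
`PKTM.monoPos_of_cellPass`: kernel cell ⇒ `0 ≤ φ_s(crossF_s 𝓜_{E,ℓ})` for `s ∈ [s_lo, s_hi]`,
`E ∈ [A - h, A + h]`, odd `ℓ`, no unitarity or twist condition on `E`.
-/

noncomputable section

namespace Literature.MathematicalPhysics.QuantumFieldTheory.ConformalBootstrap3D

namespace PKTM

open Literature.Analysis.ValidatedNumerics (rall vget vtab vget_vtab length_vtab)
open Literature.Analysis.ValidatedNumerics.PolyMP
open Literature.Analysis.ValidatedNumerics.NumericsMP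
open Literature.Analysis.ValidatedNumerics.Numerics (cdiv fdiv_mul_le_real le_cdiv_mul_real)
open PointKernel (mulQ mem_mulQ PowReq PCert legTab vget_legTab zLegendreQ cast_zLegendreQ
  zLegendreQ_nonneg)
open Finset Real

/-! ### The parity-free floor form of the node head sum -/

/-- The floor form `Σ_{m ≤ n_F} Σ_{j ≤ ℓ + (n_F - m)} A_{n_F-m, j}(Δ) · u^{⌊(n_F-m)/2⌋} ·
(𝒫_j(x,y) / u^{⌊j/2⌋})`, `u = xy` — the real function enclosed by the integer moment fold for any
parity of `ℓ` (non-Prop plumbing). [folklore] -/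
def headFloorForm (ℓ nF : ℕ) (x y Δ : ℝ) : ℝ :=
  ∑ m ∈ range (nF + 1), ∑ j ∈ range (ℓ + (nF - m) + 1),
    hrCoeff Δ ℓ (nF - m) j * ((x * y) ^ ((nF - m) / 2) * (zLegendre j x y / (x * y) ^ (j / 2)))

/-- **Node moment model, parity-free form.** For a positive node `(x, y)` and the rows of
`HRTM.rows` under the pivot condition, `ρ ↦ headFloorForm ℓ n_F x y (A + ρ)` lies in `nodeMomTM`
on `|ρ| ≤ 2^{-e}` — for every parity of `ℓ` (for even `ℓ` the floor form is the head sum itself,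
`tmem_moments`). [cite: HogervorstRychkov2013, §3 eq. (3.9)] -/
theorem tmem_moments_gform {S : ℕ} (hS : 0 < S) {A : ℚ} {ℓ e D nF : ℕ} (hD : 1 ≤ D)
    (hpiv : HRTM.pivOK A ℓ e nF = true) {x y : ℚ} (hx : 0 < x) (hy : 0 < y) :
    TMem S ((1 : ℚ) / 2 ^ e) (fun ρ => headFloorForm ℓ nF (x : ℝ) (y : ℝ) ((A : ℝ) + ρ))
      (nodeMomTM S A ℓ e D nF x y) := by
  intro ρ hρ
  set rs := HRTM.rows S A ℓ e D nF with hrs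
  -- witnesses of the coefficient models at `ρ`
  have hW : ∀ n j, ∃ as : List ℝ, n ≤ nF →
      PMem S as (HRTM.rowEntry rs nF n j) ∧ hrCoeff ((A : ℝ) + ρ) ℓ n j = evalR as ρ := by
    intro n j
    by_cases hn : n ≤ nF
    · obtain ⟨as, h1, h2⟩ := HRTM.tmem_rows (S := S) hD hpiv hn j ρ hρ
      exact ⟨as, fun _ => ⟨h1, h2⟩⟩
    · exact ⟨[], fun h => absurd h hn⟩
  choose as has using hW
  have hlen : ∀ n ≤ nF, ∀ j, (as n j).length ≤ D + 1 := fun n hn j => by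
    rw [(has n j hn).1.length_eq]; exact HRTM.length_rowEntry_le hD hpiv hn j
  -- the real factors
  set uq : ℚ := x * y with huq
  have huq0 : 0 < uq := mul_pos hx hy
  set u : ℝ := (x : ℝ) * y with hu
  have hu0 : 0 < u := by rw [hu]; exact_mod_cast mul_pos hx hy
  have hcast : ((uq : ℚ) : ℝ) = u := by rw [huq, hu]; push_cast; rfl
  set α : ℕ → ℝ := fun n => u ^ (n / 2) with hα
  set β : ℕ → ℝ := fun j => zLegendre j (x : ℝ) (y : ℝ) / u ^ (j / 2) with hβ
  have hα0 : ∀ n, 0 ≤ α n := fun n => pow_nonneg hu0.le _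
  have hβ0 : ∀ j, 0 ≤ β j := fun j =>
    div_nonneg (zLegendre_nonneg j (by exact_mod_cast hx.le) (by exact_mod_cast hy.le)) (pow_nonneg hu0.le _)
  set g : ℕ → ℝ := fun i => ∑ m ∈ range (nF + 1), α (nF - m) *
      ∑ j ∈ range (ℓ + (nF - m) + 1), (as (nF - m) j).getD i 0 * β j with hg
  -- floors
  set utr := uTabR S uq nF with hutr
  set vt := vTab S uq (legTab (ℓ + nF) x y) (ℓ + nF) with hvt
  have hrs_len : rs.length = nF + 1 := length_rows S A ℓ e D nF
  have hutr_len : utr.length = nF + 1 := by simp [hutr, uTabR]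
  have hvt_len : vt.length = ℓ + nF + 1 := by simp [hvt, vTab]
  have hrow_len : ∀ m < rs.length, (rs.getD m []).length = ℓ + (nF - m) + 1 := fun m hm =>
    length_getD_rows S A ℓ e D nF m (by omega)
  have hU : ∀ m < nF + 1, ((utr.getD m 0 : ℤ) : ℝ) ≤ α (nF - m) * S ∧
      α (nF - m) * S ≤ ((utr.getD m 0 : ℤ) : ℝ) + 1 ∧ (0 : ℝ) ≤ ((utr.getD m 0 : ℤ) : ℝ) := by
    intro m hm
    have e1 : utr.getD m 0 = flS S (uq ^ ((nF - m) / 2)) := by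
      rw [hutr, uTabR, HRTM.getD_vtab, if_pos hm]
    have e2 : α (nF - m) = ((uq ^ ((nF - m) / 2) : ℚ) : ℝ) := by
      simp only [hα, ← hcast, Rat.cast_pow]
    rw [e1, e2]
    exact ⟨flS_le S _, le_flS_add_one S _, flS_nonneg S (pow_nonneg huq0.le _)⟩
  have hV : ∀ j < ℓ + nF + 1, ((vt.getD j 0 : ℤ) : ℝ) ≤ β j * S ∧
      β j * S ≤ ((vt.getD j 0 : ℤ) : ℝ) + 1 ∧ (0 : ℝ) ≤ ((vt.getD j 0 : ℤ) : ℝ) := by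
    intro j hj
    have e1 : vt.getD j 0 = flS S (zLegendreQ j x y / uq ^ (j / 2)) := by
      rw [hvt, vTab, HRTM.getD_vtab, if_pos hj, vget_legTab (by omega)]
    have e2 : β j = ((zLegendreQ j x y / uq ^ (j / 2) : ℚ) : ℝ) := by
      simp only [hβ, ← hcast, Rat.cast_div, Rat.cast_pow, cast_zLegendreQ]
    rw [e1, e2]
    exact ⟨flS_le S _, le_flS_add_one S _,
      flS_nonneg S (div_nonneg (zLegendreQ_nonneg j hx.le hy.le) (pow_nonneg huq0.le _))⟩
  -- coefficient membership: `lo_{n,j,i} ≤ a_{n,j,i} S ≤ hi_{n,j,i}`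
  have hA : ∀ m < nF + 1, ∀ j i, MI.mem S ((as (nF - m) j).getD i 0) (HRTM.cf ((rs.getD m []).getD j []) i) := by
    intro m hm j i
    rw [getD_getD_eq_rowEntry rs (by omega : m ≤ nF)]
    exact HRTM.mem_cf (has (nF - m) j (by omega)).1 i
  refine ⟨(List.range (D + 1)).map g, ?_, ?_⟩
  · -- membership of the moments
    unfold nodeMomTM momPoly
    refine pmem_map_range_lt (D + 1) fun i hi => ?_
    have hSS : (0 : ℤ) < ((S * S : ℕ) : ℤ) := by exact_mod_cast Nat.mul_pos hS hS
    have hms := getD_moments rs utr vt D (by rw [hrs_len, hutr_len])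
      (fun m hm => by rw [hrow_len m hm, hvt_len]; have := hrs_len; omega) hi
    -- the scaled target
    have hgS : g i * S ^ 3 = ∑ m ∈ range (nF + 1),
        (∑ j ∈ range (ℓ + (nF - m) + 1), ((as (nF - m) j).getD i 0 * S) * (β j * S)) * (α (nF - m) * S) := by
      rw [hg, sum_mul]
      refine sum_congr rfl fun m _ => ?_
      simp only [mul_sum, sum_mul]
      refine sum_congr rfl fun j _ => ?_
      ring
    have hlo : (((moments rs utr vt D).getD i (0, 0)).1 : ℝ) ≤ g i * S ^ 3 := by
      rw [hms, hgS]
      push_cast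
      rw [hrs_len]
      refine sum_le_sum fun m hm => ?_
      have hm' := mem_range.mp hm
      obtain ⟨hU1, hU2, hU3⟩ := hU m hm'
      refine selLo_le ?_ (mul_nonneg (hα0 _) (Nat.cast_nonneg S)) hU1 hU2
      rw [hrow_len m (by rw [hrs_len]; exact hm')]
      push_cast
      refine sum_le_sum fun j hj => ?_
      have hj' : j < ℓ + nF + 1 := by have := mem_range.mp hj; omega
      obtain ⟨hV1, hV2, hV3⟩ := hV j hj'
      exact selLo_le (hA m hm' j i).1 (mul_nonneg (hβ0 _) (Nat.cast_nonneg S)) hV1 hV2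
    have hhi : g i * S ^ 3 ≤ (((moments rs utr vt D).getD i (0, 0)).2 : ℝ) := by
      rw [hms, hgS]
      push_cast
      rw [hrs_len]
      refine sum_le_sum fun m hm => ?_
      have hm' := mem_range.mp hm
      obtain ⟨hU1, hU2, hU3⟩ := hU m hm'
      refine le_selHi ?_ (mul_nonneg (hα0 _) (Nat.cast_nonneg S)) hU3 hU1 hU2
      rw [hrow_len m (by rw [hrs_len]; exact hm')]
      push_cast
      refine sum_le_sum fun j hj => ?_
      have hj' : j < ℓ + nF + 1 := by have := mem_range.mp hj; omega
      obtain ⟨hV1, hV2, hV3⟩ := hV j hj'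
      exact le_selHi (hA m hm' j i).2 (mul_nonneg (hβ0 _) (Nat.cast_nonneg S)) hV3 hV1 hV2
    have hS3 : (S : ℝ) ^ 3 = S * ((S * S : ℕ) : ℝ) := by push_cast; ring
    have hSSr : (0 : ℝ) < ((S * S : ℕ) : ℤ) := by exact_mod_cast hSS
    simp only [MI.mem]
    constructor
    · have h1 := fdiv_mul_le_real (a := ((moments rs utr vt D).getD i (0, 0)).1) hSS
      have h2 : g i * S * (((S * S : ℕ) : ℤ) : ℝ) = g i * S ^ 3 := by push_cast; ring
      nlinarith
    · have h1 := le_cdiv_mul_real (a := ((moments rs utr vt D).getD i (0, 0)).2) hSS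
      have h2 : g i * S * (((S * S : ℕ) : ℤ) : ℝ) = g i * S ^ 3 := by push_cast; ring
      nlinarith
  · -- the identity `floor form (A + ρ) = Σ_i g_i ρ^i`
    rw [evalR_map_range]
    show headFloorForm ℓ nF (x : ℝ) (y : ℝ) ((A : ℝ) + ρ) = _
    have hE : ∀ m ∈ range (nF + 1), ∀ j, evalR (as (nF - m) j) ρ =
        ∑ i ∈ range (D + 1), (as (nF - m) j).getD i 0 * ρ ^ i := fun m hm j =>
      (HRTM.sum_getD_eq_evalR ρ (as (nF - m) j) (D + 1) (hlen _ (by have := mem_range.mp hm; omega) j)).symm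
    have key : ∑ m ∈ range (nF + 1), ∑ j ∈ range (ℓ + (nF - m) + 1),
        hrCoeff ((A : ℝ) + ρ) ℓ (nF - m) j * (α (nF - m) * β j) = ∑ i ∈ range (D + 1), g i * ρ ^ i := by
      calc ∑ m ∈ range (nF + 1), ∑ j ∈ range (ℓ + (nF - m) + 1),
            hrCoeff ((A : ℝ) + ρ) ℓ (nF - m) j * (α (nF - m) * β j)
          = ∑ m ∈ range (nF + 1), ∑ j ∈ range (ℓ + (nF - m) + 1), ∑ i ∈ range (D + 1),
              α (nF - m) * ((as (nF - m) j).getD i 0 * β j) * ρ ^ i := by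
            refine sum_congr rfl fun m hm => sum_congr rfl fun j _ => ?_
            rw [(has (nF - m) j (by have := mem_range.mp hm; omega)).2, hE m hm j, sum_mul]
            exact sum_congr rfl fun i _ => by ring
        _ = ∑ m ∈ range (nF + 1), ∑ i ∈ range (D + 1), ∑ j ∈ range (ℓ + (nF - m) + 1),
              α (nF - m) * ((as (nF - m) j).getD i 0 * β j) * ρ ^ i :=
            sum_congr rfl fun m _ => sum_comm
        _ = ∑ i ∈ range (D + 1), ∑ m ∈ range (nF + 1), ∑ j ∈ range (ℓ + (nF - m) + 1),
              α (nF - m) * ((as (nF - m) j).getD i 0 * β j) * ρ ^ i := sum_comm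
        _ = ∑ i ∈ range (D + 1), g i * ρ ^ i := by
            refine sum_congr rfl fun i _ => ?_
            rw [hg, sum_mul]
            refine sum_congr rfl fun m _ => ?_
            rw [mul_sum, sum_mul]
    rw [← key]
    simp only [headFloorForm, hα, hβ, hu]

/-- At head level zero and odd spin `ℓ = 2k+1` the floor form is `u^{1/2} H`: both equal
`𝒫_ℓ / u^k` (`A_{0,ℓ} = 1`, `A_{0,j} = 0` for `j ≠ ℓ`). [folklore] -/
private theorem headFloorForm_zero_odd {ℓ : ℕ} (hℓ : Odd ℓ) {x y : ℝ} (hx : 0 < x) (hy : 0 < y)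
    (Δ : ℝ) : (x * y) ^ ((1 : ℝ) / 2) * nodeHead ℓ 0 x y Δ = headFloorForm ℓ 0 x y Δ := by
  have hxy : 0 < x * y := mul_pos hx hy
  obtain ⟨k, hk⟩ := hℓ
  have hk2 : ℓ / 2 = k := by omega
  have hL : nodeHead ℓ 0 x y Δ = (x * y) ^ ((((0 : ℕ) : ℝ) - ((ℓ : ℕ) : ℝ)) / 2) * zLegendre ℓ x y := by
    unfold nodeHead
    exact head_sum_zero Δ ℓ (fun q => (x * y) ^ (((q.1 : ℝ) - q.2) / 2) * zLegendre q.2 x y)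
  have hR : headFloorForm ℓ 0 x y Δ = zLegendre ℓ x y / (x * y) ^ (ℓ / 2) := by
    unfold headFloorForm
    simp only [zero_add, Finset.sum_range_one, Nat.sub_zero, Nat.zero_div, pow_zero, one_mul, add_zero]
    rw [Finset.sum_eq_single ℓ, hrCoeff_zero_self, one_mul]
    · intro j _ hj; rw [hrCoeff_zero_of_ne Δ hj, zero_mul]
    · intro h; exact absurd (Finset.mem_range.2 (Nat.lt_succ_self ℓ)) h
  have hpow : (x * y) ^ ((1 : ℝ) / 2) * (x * y) ^ ((((0 : ℕ) : ℝ) - ((ℓ : ℕ) : ℝ)) / 2) =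
      ((x * y) ^ k)⁻¹ := by
    rw [← Real.rpow_add hxy]
    have e : (1 : ℝ) / 2 + (((0 : ℕ) : ℝ) - ((ℓ : ℕ) : ℝ)) / 2 = -(k : ℝ) := by
      rw [hk]; push_cast; ring
    rw [e, Real.rpow_neg hxy.le, Real.rpow_natCast]
  rw [hL, hR, hk2, ← mul_assoc, hpow, inv_mul_eq_div]

/-- **Node moment model at head level zero, odd spin**: the model `nodeMomTM` (computed by the
SAME integer fold as for even spin) encloses `ρ ↦ (xy)^{1/2} H(x, y, A + ρ)` on `|ρ| ≤ 2^{-e}`.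
[cite: HogervorstRychkov2013, §3 eq. (3.9)] -/
theorem tmem_moments_odd {S : ℕ} (hS : 0 < S) {A : ℚ} {ℓ e D nF : ℕ} (hℓ : Odd ℓ) (hnF : nF = 0)
    (hD : 1 ≤ D) (hpiv : HRTM.pivOK A ℓ e nF = true) {x y : ℚ} (hx : 0 < x) (hy : 0 < y) :
    TMem S ((1 : ℚ) / 2 ^ e)
      (fun ρ => ((x * y : ℚ) : ℝ) ^ ((1 : ℝ) / 2) * nodeHead ℓ nF (x : ℝ) (y : ℝ) ((A : ℝ) + ρ))
      (nodeMomTM S A ℓ e D nF x y) := by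
  subst hnF
  refine tmem_congr_on (tmem_moments_gform hS hD hpiv hx hy) fun ρ _ => ?_
  rw [Rat.cast_mul]
  exact (headFloorForm_zero_odd hℓ (by exact_mod_cast hx) (by exact_mod_cast hy) _).symm

/-! ### One node side, odd spin -/

/-- **Soundness of one node side, odd spin at head level zero**: with `Ef ∋ (xy)^{(A-1)/2}` in
place of `(xy)^{A/2}` the unchanged `sideCore` encloses the three `θ`-coefficients
`a · c_m(r) · (xy)^{(A+ρ)/2} H(x, y, A+ρ)`. [cite: HogervorstRychkov2013, §3 eq. (3.6)] -/
theorem tmem_sideCore_odd {S : ℕ} (hS : 0 < S) {t : TMCell} (hD : 1 ≤ t.D) (hK : 0 < t.K)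
    (hℓ : Odd t.ℓ) (hnF : t.nF = 0) (hpiv : HRTM.pivOK t.A t.ℓ t.e t.nF = true) {x y : ℚ}
    (hx : 0 < x) (hy : 0 < y) {a r : ℝ} {amp R Ef : MI} (hamp : MI.mem S a amp) (hR : MI.mem S r R)
    (hEf : MI.mem S (((x * y : ℚ) : ℝ) ^ (((t.A : ℝ) - 1) / 2)) Ef) {lo : Bool}
    (hlo : lo = true ↔ 0 ≤ a) {g : G3}
    (h : sideCore S t (HRTM.rows S t.A t.ℓ t.e t.D t.nF) x y amp R Ef lo = some g) :
    ∀ m, m ≤ 2 → TMem S t.h (fun ρ => a * qselCoeff a r m *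
      (((x * y : ℚ) : ℝ) ^ (((t.A : ℝ) + ρ) / 2) * nodeHead t.ℓ t.nF (x : ℝ) (y : ℝ) ((t.A : ℝ) + ρ)))
      (gsel g m) := by
  have huq : 0 < x * y := mul_pos hx hy
  have hu : (0 : ℝ) < ((x * y : ℚ) : ℝ) := by exact_mod_cast huq
  have hh0 : 0 ≤ t.h := by unfold TMCell.h; positivity
  unfold sideCore at h
  cases hL : MI.logPos S t.Klog (MI.ofFrac S (x * y).num (x * y).den) with
  | none => simp [hL] at h
  | some L =>
    cases hq : qCoeffs S lo R with
    | none => simp [hL, hq] at h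
    | some cc =>
      simp only [hL, hq] at h
      split_ifs at h with hB
      obtain rfl := Option.some.inj h
      -- the factors
      have hX : MI.mem S (((x * y : ℚ) : ℝ)) (MI.ofFrac S (x * y).num (x * y).den) := by
        have := MI.mem_ofFrac S (x * y).num (x * y).den_pos
        rwa [show (((x * y).num : ℝ)) / ((x * y).den) = ((x * y : ℚ) : ℝ) by
          rw [Rat.cast_def]] at this
      obtain ⟨-, hlog⟩ := MI.mem_logPos hS hL hX
      have hΛ : MI.mem S (Real.log ((x * y : ℚ) : ℝ) / 2) (L.divNat 2) := by
        simpa using MI.mem_divNat hlog (by norm_num : 0 < 2)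
      have hT := tmem_expMI hS hK hΛ hB
      have hM : TMem S t.h (fun ρ => ((x * y : ℚ) : ℝ) ^ ((1 : ℝ) / 2) *
            nodeHead t.ℓ t.nF (x : ℝ) (y : ℝ) ((t.A : ℝ) + ρ))
          (momPoly S t.D (moments (HRTM.rows S t.A t.ℓ t.e t.D t.nF) (uTabR S (x * y) t.nF)
            (vTab S (x * y) (legTab (t.ℓ + t.nF) x y) (t.ℓ + t.nF)) t.D)) :=
        tmem_moments_odd hS hℓ hnF hD hpiv hx hy
      have hF := tmem_mul hS hh0 t.D hM hT
      have hκ := MI.mem_mul hS hamp hEf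
      obtain ⟨hc1, hc2⟩ := mem_qCoeffs hS hR hlo hq
      -- the pointwise identity `(xy)^{(A+ρ)/2} = (xy)^{(A-1)/2} (xy)^{1/2} e^{ρ log(xy)/2}`
      have hsplit : ∀ ρ : ℝ, ((x * y : ℚ) : ℝ) ^ (((t.A : ℝ) + ρ) / 2) =
          ((x * y : ℚ) : ℝ) ^ (((t.A : ℝ) - 1) / 2) * ((x * y : ℚ) : ℝ) ^ ((1 : ℝ) / 2) *
            Real.exp (Real.log ((x * y : ℚ) : ℝ) / 2 * ρ) := by
        intro ρ
        rw [show ((t.A : ℝ) + ρ) / 2 = ((t.A : ℝ) - 1) / 2 + 1 / 2 + ρ / 2 by ring, Real.rpow_add hu,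
          Real.rpow_add hu, Real.rpow_def_of_pos hu (ρ / 2)]
        ring_nf
      intro m hm
      rcases Nat.le_succ_iff.mp hm with hm1 | rfl
      · rcases Nat.le_succ_iff.mp hm1 with hm0 | rfl
        · obtain rfl : m = 0 := Nat.le_zero.mp hm0
          refine tmem_congr_on (tmem_smulI hS hκ hF) fun ρ _ => ?_
          have e0 : qselCoeff a r 0 = 1 := by unfold qselCoeff; split_ifs <;> rfl
          simp only [e0, hsplit ρ]
          ring
        · refine tmem_congr_on (tmem_smulI hS (MI.mem_mul hS hκ hc1) hF) fun ρ _ => ?_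
          simp only [hsplit ρ]
          ring
      · refine tmem_congr_on (tmem_smulI hS (MI.mem_mul hS hκ hc2) hF) fun ρ _ => ?_
        simp only [hsplit ρ]
        ring

/-- **Soundness of a node side, odd spin at head level zero** (power request `rA` of the cell =
the exponent `(A-1)/2`). [cite: HogervorstRychkov2013, §3 eq. (3.6)] -/
theorem tmem_sideG_odd {c : PCert} (hc : c.checkNodes = true) {t : TMCell} {p : TMPiece}
    (hD : 1 ≤ t.D) (hK : 0 < t.K) (hℓ : Odd t.ℓ) (hnF : t.nF = 0)
    (hpiv : HRTM.pivOK t.A t.ℓ t.e t.nF = true) (hrA : t.rA.ok = true)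
    (hrS : p.rSig.ok = true) (hrD : p.rDel.ok = true) (hA : t.rA.expo c.rho = (t.A - 1) / 2)
    {k : ℕ} (hk : k < c.N) {g1 g2 : G3}
    (h1 : sideG c t p (HRTM.rows c.S t.A t.ℓ t.e t.D t.nF) k true = some g1)
    (h2 : sideG c t p (HRTM.rows c.S t.A t.ℓ t.e t.D t.nF) k false = some g2) :
    ∀ m, m ≤ 2 → TMem c.S t.h
      (fun ρ => nodeGN c t.ℓ t.nF (expoR c p.rSig) (expoR c p.rDel) k m ((t.A : ℝ) + ρ))
      (gsel (addG g1 g2) m) := by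
  have hS := PCert.S_pos hc
  have hn := PCert.checkNode_of_checkNodes hc hk
  have hz := PCert.z_pos hn
  have hzb := PCert.zb_pos hn
  have hz1 := PCert.z_lt_one hn
  have hzb1 := PCert.zb_lt_one hn
  have hAe : ((t.rA.expo c.rho : ℚ) : ℝ) = ((t.A : ℝ) - 1) / 2 := by rw [hA]; push_cast; ring
  -- casts of `u_k`, `v_k`
  have eu : ((c.u k : ℚ) : ℝ) = (c.z k : ℝ) * (c.zb k : ℝ) := by rw [PCert.u]; push_cast; ring
  have ev : ((c.v k : ℚ) : ℝ) = (1 - (c.z k : ℝ)) * (1 - (c.zb k : ℝ)) := by rw [PCert.v]; push_cast; ring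
  have hz1r : ((c.z k : ℚ) : ℝ) < 1 := by exact_mod_cast hz1
  have hzb1r : ((c.zb k : ℚ) : ℝ) < 1 := by exact_mod_cast hzb1
  have hvpos : (0 : ℝ) < (1 - (c.z k : ℝ)) * (1 - (c.zb k : ℝ)) :=
    mul_pos (by linarith) (by linarith)
  have hupos : (0 : ℝ) < (c.z k : ℝ) * (c.zb k : ℝ) :=
    mul_pos (by exact_mod_cast hz) (by exact_mod_cast hzb)
  unfold sideG at h1 h2
  simp only [if_true] at h1
  simp only [Bool.false_eq_true, if_false] at h2
  -- plus side
  have hamp1 : MI.mem c.S ((c.w k : ℝ) * ((1 - (c.z k : ℝ)) * (1 - (c.zb k : ℝ))) ^ expoR c p.rSig)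
      (mulQ (c.powV k p.rSig) (c.w k)) := by
    have := mem_mulQ (PCert.mem_powV hn hS p.rSig hrS) (c.w k)
    rw [ev] at this
    simpa [expoR, mul_comm] using this
  have hR1 : MI.mem c.S (((1 - (c.z k : ℝ)) * (1 - (c.zb k : ℝ))) ^ expoR c p.rDel) (c.powV k p.rDel) := by
    have := PCert.mem_powV hn hS p.rDel hrD; rwa [ev] at this
  have hEf1 : MI.mem c.S (((c.z k * c.zb k : ℚ) : ℝ) ^ (((t.A : ℝ) - 1) / 2)) (c.powU k t.rA) := by
    have := PCert.mem_powU hn hS t.rA hrA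
    rwa [hAe, show c.u k = c.z k * c.zb k from rfl] at this
  have hlo1 : decide (0 ≤ c.w k) = true ↔
      0 ≤ (c.w k : ℝ) * ((1 - (c.z k : ℝ)) * (1 - (c.zb k : ℝ))) ^ expoR c p.rSig := by
    rw [decide_eq_true_iff, mul_nonneg_iff_of_pos_right (Real.rpow_pos_of_pos hvpos _)]
    exact ⟨fun h => by exact_mod_cast h, fun h => by exact_mod_cast h⟩
  have P1 := tmem_sideCore_odd hS hD hK hℓ hnF hpiv hz hzb hamp1 hR1 hEf1 hlo1 h1
  -- minus side
  have hx2 : 0 < 1 - c.z k := by linarith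
  have hy2 : 0 < 1 - c.zb k := by linarith
  have hamp2 : MI.mem c.S (-((c.w k : ℝ) * ((c.z k : ℝ) * (c.zb k : ℝ)) ^ expoR c p.rSig))
      (mulQ (c.powU k p.rSig) (-(c.w k))) := by
    have := mem_mulQ (PCert.mem_powU hn hS p.rSig hrS) (-(c.w k))
    rw [eu] at this
    simpa [expoR, mul_comm] using this
  have hR2 : MI.mem c.S (((c.z k : ℝ) * (c.zb k : ℝ)) ^ expoR c p.rDel) (c.powU k p.rDel) := by
    have := PCert.mem_powU hn hS p.rDel hrD; rwa [eu] at this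
  have hEf2 : MI.mem c.S ((((1 - c.z k) * (1 - c.zb k) : ℚ) : ℝ) ^ (((t.A : ℝ) - 1) / 2))
      (c.powV k t.rA) := by
    have := PCert.mem_powV hn hS t.rA hrA
    rwa [hAe, show c.v k = (1 - c.z k) * (1 - c.zb k) from rfl] at this
  have hlo2 : decide (c.w k ≤ 0) = true ↔
      0 ≤ -((c.w k : ℝ) * ((c.z k : ℝ) * (c.zb k : ℝ)) ^ expoR c p.rSig) := by
    have hP := Real.rpow_pos_of_pos hupos (expoR c p.rSig)
    rw [decide_eq_true_iff]
    constructor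
    · intro h
      have h' : ((c.w k : ℚ) : ℝ) ≤ 0 := by exact_mod_cast h
      nlinarith
    · intro h
      have h' : ((c.w k : ℚ) : ℝ) ≤ 0 := by
        by_contra hneg
        have := mul_pos (lt_of_not_ge hneg) hP
        linarith
      exact_mod_cast h'
  have P2 := tmem_sideCore_odd hS hD hK hℓ hnF hpiv hx2 hy2 hamp2 hR2 hEf2 hlo2 h2
  intro m hm
  rw [gsel_addG]
  refine tmem_congr_on (tmem_add (P1 m hm) (P2 m hm)) fun ρ _ => ?_
  simp only [nodeGN]
  push_cast
  ring

/-! ### Groups, partitions and the cell number under an abstract node-side hypothesis -/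

/-- **Node-side soundness on a cell** (abstract form of `tmem_sideG` / `tmem_sideG_odd`): both
sides of every node, as computed by `sideG` from the recursion table of the cell, enclose the real
node term `nodeGN` in `ρ = Δ - A` on `|ρ| ≤ h`. [cite: HogervorstRychkov2013, §3 eq. (3.6)] -/
def SideSound (c : PCert) (t : TMCell) (p : TMPiece) : Prop :=
  ∀ k < c.N, ∀ g1 g2 : G3, sideG c t p (HRTM.rows c.S t.A t.ℓ t.e t.D t.nF) k true = some g1 →
    sideG c t p (HRTM.rows c.S t.A t.ℓ t.e t.D t.nF) k false = some g2 →
    ∀ m, m ≤ 2 → TMem c.S t.h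
      (fun ρ => nodeGN c t.ℓ t.nF (expoR c p.rSig) (expoR c p.rDel) k m ((t.A : ℝ) + ρ))
      (gsel (addG g1 g2) m)

/-- Even spin: `SideSound` from `tmem_sideG`. [cite: HogervorstRychkov2013, §3 eq. (3.6)] -/
theorem sideSound_even {c : PCert} (hc : c.checkNodes = true) {t : TMCell} {p : TMPiece}
    (hD : 1 ≤ t.D) (hK : 0 < t.K) (hℓ : Even t.ℓ) (hpiv : HRTM.pivOK t.A t.ℓ t.e t.nF = true)
    (hrA : t.rA.ok = true) (hrS : p.rSig.ok = true) (hrD : p.rDel.ok = true)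
    (hA : t.rA.expo c.rho = t.A / 2) : SideSound c t p :=
  fun _ hk _ _ h1 h2 => tmem_sideG hc hD hK hℓ hpiv hrA hrS hrD hA hk h1 h2

/-- Odd spin at head level zero: `SideSound` from `tmem_sideG_odd` (request `rA` = `(A-1)/2`).
[cite: HogervorstRychkov2013, §3 eq. (3.6)] -/
theorem sideSound_odd {c : PCert} (hc : c.checkNodes = true) {t : TMCell} {p : TMPiece}
    (hD : 1 ≤ t.D) (hK : 0 < t.K) (hℓ : Odd t.ℓ) (hnF : t.nF = 0)
    (hpiv : HRTM.pivOK t.A t.ℓ t.e t.nF = true) (hrA : t.rA.ok = true) (hrS : p.rSig.ok = true)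
    (hrD : p.rDel.ok = true) (hA : t.rA.expo c.rho = (t.A - 1) / 2) : SideSound c t p :=
  fun _ hk _ _ h1 h2 => tmem_sideG_odd hc hD hK hℓ hnF hpiv hrA hrS hrD hA hk h1 h2

section Sound

variable {c : PCert} {t : TMCell} {p : TMPiece} (hss : SideSound c t p)
include hss

/-- [folklore] -/
private theorem tmem_gPartAux_ss : ∀ (n k : ℕ) (acc : G3) {g : G3} (F : ℕ → ℝ → ℝ),
    (∀ m, m ≤ 2 → TMem c.S t.h (F m) (gsel acc m)) → k + n ≤ c.N →
    gPartAux c t p (HRTM.rows c.S t.A t.ℓ t.e t.D t.nF) n k acc = some g →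
    ∀ m, m ≤ 2 → TMem c.S t.h (fun ρ => F m ρ + ∑ i ∈ Finset.Ico k (k + n),
      nodeGN c t.ℓ t.nF (expoR c p.rSig) (expoR c p.rDel) i m ((t.A : ℝ) + ρ)) (gsel g m)
  | 0, k, acc, g, F, hF, _, h, m, hm => by
    simp only [gPartAux, Option.some.injEq] at h
    subst h
    exact tmem_congr_on (hF m hm) fun ρ _ => by simp
  | n + 1, k, acc, g, F, hF, hkN, h, m, hm => by
    simp only [gPartAux] at h
    cases h1 : sideG c t p (HRTM.rows c.S t.A t.ℓ t.e t.D t.nF) k true with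
    | none => simp [h1] at h
    | some g1 =>
      cases h2 : sideG c t p (HRTM.rows c.S t.A t.ℓ t.e t.D t.nF) k false with
      | none => simp [h1, h2] at h
      | some g2 =>
        simp only [h1, h2] at h
        have hk : k < c.N := by omega
        have hnode := hss k hk g1 g2 h1 h2
        have hacc : ∀ m, m ≤ 2 → TMem c.S t.h (fun ρ => F m ρ +
            nodeGN c t.ℓ t.nF (expoR c p.rSig) (expoR c p.rDel) k m ((t.A : ℝ) + ρ))
            (gsel (addG acc (addG g1 g2)) m) := fun m hm => by
          rw [gsel_addG]; exact tmem_add (hF m hm) (hnode m hm)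
        have ih := tmem_gPartAux_ss n (k + 1) (addG acc (addG g1 g2)) _ hacc (by omega) h m hm
        refine tmem_congr_on ih fun ρ _ => ?_
        rw [Finset.sum_eq_sum_Ico_succ_bot (by omega : k < k + (n + 1)),
          show k + 1 + n = k + (n + 1) by omega]
        ring

/-- [folklore] -/
private theorem tmem_gPart_ss {klo khi : ℕ} {g : G3} (h : gPart c t p klo khi = some g)
    (hN : khi ≤ c.N) (hkk : klo ≤ khi) : ∀ m, m ≤ 2 → TMem c.S t.h (fun ρ => ∑ i ∈ Finset.Ico klo khi,
      nodeGN c t.ℓ t.nF (expoR c p.rSig) (expoR c p.rDel) i m ((t.A : ℝ) + ρ)) (gsel g m) := by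
  intro m hm
  have h0 : ∀ m, m ≤ 2 → TMem c.S t.h ((fun _ _ => (0 : ℝ)) m) (gsel (([], [], []) : G3) m) :=
    fun m _ => by rw [gsel_empty]; exact HRTM.tmem_nil_zero c.S t.h
  have := tmem_gPartAux_ss hss (khi - klo) klo ([], [], []) (fun _ _ => (0 : ℝ)) h0 (by omega) h m hm
  refine tmem_congr_on this fun ρ _ => ?_
  simp only [zero_add, show klo + (khi - klo) = khi by omega]

/-- [folklore] -/
private theorem tmem_parts_ss {k0 k1 : ℕ} {gs : List G3} (hP : PartsOK c t p k0 k1 gs)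
    (hN : k1 ≤ c.N) : ∀ m, m ≤ 2 → TMem c.S t.h (fun ρ => ∑ i ∈ Finset.Ico k0 k1,
      nodeGN c t.ℓ t.nF (expoR c p.rSig) (expoR c p.rDel) i m ((t.A : ℝ) + ρ)) (gsel (sumG gs) m) := by
  induction hP with
  | nil k =>
    intro m _
    rw [show sumG ([] : List G3) = ([], [], []) from rfl, gsel_empty]
    exact HRTM.tmem_nil_of_eq_zero fun ρ => by simp
  | cons hk h hs ih =>
    intro m hm
    rw [sumG_cons, gsel_addG]
    refine tmem_congr_on (tmem_add (tmem_gPart_ss hss h (hs.le.trans hN) hk m hm) (ih hN m hm))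
      fun ρ _ => ?_
    rw [Finset.sum_Ico_consecutive _ hk hs.le]

/-- **Cell number ⇒ non-negative quadratic minorant**, under abstract node-side soundness: the
`hpos` hypothesis of `blockPositive_pointFunctional_of_headG_Ico` on `[A - h, A + h]` (same
conclusion as `headG_nonneg_of_cellNumber`). [cite: HogervorstRychkov2013, §3 eq. (3.6)] -/
theorem headG_nonneg_of_sideSound (hc : c.checkNodes = true) {gs : List G3}
    (hP : PartsOK c t p 0 c.N gs) (hnum : 0 ≤ cellNumber c.S t.h gs) :
    ∀ Δ ∈ Set.Icc ((t.A : ℝ) - t.h) ((t.A : ℝ) + t.h), ∀ θ ∈ Set.Icc (0 : ℝ) 1,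
      0 ≤ headG c.wR c.zR c.zbR t.ℓ t.nF (expoR c p.rSig) (expoR c p.rDel) 0 Δ
        + θ * headG c.wR c.zR c.zbR t.ℓ t.nF (expoR c p.rSig) (expoR c p.rDel) 1 Δ
        + θ ^ 2 * headG c.wR c.zR c.zbR t.ℓ t.nF (expoR c p.rSig) (expoR c p.rDel) 2 Δ := by
  intro Δ hΔ θ hθ
  have hS := PCert.S_pos hc
  have hSr : (0 : ℝ) < c.S := by exact_mod_cast hS
  have hh0 : 0 ≤ t.h := by unfold TMCell.h; positivity
  have hρ : |Δ - t.A| ≤ (t.h : ℝ) := abs_le.mpr ⟨by linarith [hΔ.1], by linarith [hΔ.2]⟩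
  have hG := tmem_parts_ss hss hP le_rfl
  have hmain := lower3_le hh0 (hG 0 (by norm_num)) (hG 1 (by norm_num)) (hG 2 le_rfl) hθ.1 hθ.2 hρ
  have e : ∀ m, headG c.wR c.zR c.zbR t.ℓ t.nF (expoR c p.rSig) (expoR c p.rDel) m Δ =
      ∑ i ∈ Finset.Ico 0 c.N, nodeGN c t.ℓ t.nF (expoR c p.rSig) (expoR c p.rDel) i m
        ((t.A : ℝ) + (Δ - t.A)) := by
    intro m
    rw [show (t.A : ℝ) + (Δ - t.A) = Δ by ring, ← Finset.range_eq_Ico]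
    unfold headG
    simp only [nodeG_eq_nodeGN]
    exact Fin.sum_univ_eq_sum_range
      (fun i => nodeGN c t.ℓ t.nF (expoR c p.rSig) (expoR c p.rDel) i m Δ) c.N
  have h0 : (0 : ℝ) ≤ (lower3 c.S t.h (gsel (sumG gs) 0) (gsel (sumG gs) 1) (gsel (sumG gs) 2) : ℤ) := by
    have : 0 ≤ lower3 c.S t.h (gsel (sumG gs) 0) (gsel (sumG gs) 1) (gsel (sumG gs) 2) := hnum
    exact_mod_cast this
  rw [e 0, e 1, e 2]
  by_contra hneg
  have := mul_neg_of_neg_of_pos (lt_of_not_ge hneg) hSr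
  linarith

end Sound

/-! ### The main theorem -/

/-- **Mono-term positivity from kernel cells (odd spin).** The v3 kernel run at head level
`n_F = 0` and odd spin `ℓ = j`, with the power request `rA` of the cell evaluating to `(A-1)/2`:
if every `s`-piece of the chain `s_lo = σ_0 ≤ … ≤ σ_P = s_hi` passes (`CellPass`), then
`0 ≤ φ_s(crossF_s 𝓜_{E, j})` for all `s ∈ [s_lo, s_hi]` and all `E ∈ [A - h, A + h]` — the shape of
the termwise tail hypothesis `hM` on that cell, with no unitarity or twist condition on `E`
(same conclusion as `monoPos_of_cellPass`). [cite: HogervorstRychkov2013, §3 eq. (3.6)] -/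
theorem monoPosOdd_of_cellPass {c : PCert} (hc : c.checkNodes = true) {slo shi : ℚ}
    {t : TMCell} (hD : 1 ≤ t.D) (hK : 0 < t.K) (hℓ : Odd t.ℓ) (hnF : t.nF = 0)
    (hpiv : HRTM.pivOK t.A t.ℓ t.e t.nF = true) (hrA : t.rA.ok = true)
    (hA : t.rA.expo c.rho = (t.A - 1) / 2)
    {ps : List TMPiece} {P : ℕ} (hP : 0 < P) (hch : chainOK c ps P slo shi = true)
    (hpass : ∀ i < P, CellPass c t (pc ps i)) :
    ∀ s ∈ Set.Icc ((slo : ℚ) : ℝ) ((shi : ℚ) : ℝ),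
      ∀ E ∈ Set.Icc ((t.A : ℝ) - t.h) ((t.A : ℝ) + t.h),
        0 ≤ pointFunctional c.wR c.zR c.zbR (crossF s (-1) (zMono E t.ℓ)) := by
  simp only [chainOK, Bool.and_eq_true, decide_eq_true_eq, List.all_eq_true, List.mem_range] at hch
  obtain ⟨⟨h0, hPσ⟩, hall⟩ := hch
  let σ : ℕ → ℝ := fun i => expoR c (pc ps i).rSig
  have hδ : ∀ i < P, σ (i + 1) - σ i = expoR c (pc ps i).rDel := by
    intro i hi
    obtain ⟨⟨⟨he, -⟩, -⟩, -⟩ := hall i hi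
    simp only [σ, expoR, ← he]; push_cast; ring
  have hσ0 : σ 0 = ((slo : ℚ) : ℝ) := by simp only [σ, expoR, h0]
  have hσP : σ P = ((shi : ℚ) : ℝ) := by simp only [σ, expoR, hPσ]
  intro s hs E hE
  obtain ⟨i, hi, hsi⟩ := exists_piece_Icc σ P hP s ⟨by rw [hσ0]; exact hs.1, by rw [hσP]; exact hs.2⟩
  obtain ⟨⟨⟨-, hd⟩, hrS⟩, hrD⟩ := hall i hi
  have hd' : (0 : ℝ) ≤ expoR c (pc ps i).rDel := by unfold expoR; exact_mod_cast hd
  have hsi' : s ∈ Set.Icc (σ i) (σ i + expoR c (pc ps i).rDel) := by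
    rw [← hδ i hi, show σ i + (σ (i + 1) - σ i) = σ (i + 1) by ring]; exact hsi
  obtain ⟨θ, hθ, hsθ⟩ := exists_boxCoord hsi'
  have hs' : σ i + θ * expoR c (pc ps i).rDel = s := by rw [hsθ]; ring
  obtain ⟨gs, hparts, hnum⟩ := hpass i hi
  have hq := headG_nonneg_of_sideSound (sideSound_odd hc hD hK hℓ hnF hpiv hrA hrS hrD hA) hc
    hparts hnum E hE θ hθ
  rw [hnF] at hq
  have hle := headG_quad_le_zero c.wR c.zR c.zbR (zR_mem_Ioo hc) (zbR_mem_Ioo hc) t.ℓ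
    (σ := σ i) (Δ := E) hd' hθ
  rw [hs'] at hle
  exact hq.trans hle

end PKTM

end Literature.MathematicalPhysics.QuantumFieldTheory.ConformalBootstrap3D
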